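import Literature.Barriers.QuantumAdvantage.TensorNetworkContractionEngineLists
import HarnessLib

/-!
# Barrier catalogue `QuantumAdvantage` — the value computed by the contraction engine (Markov–Shi Thm 4.6, Steps 1, 3, 4)

Companion to `TensorNetworkContractionEngineLists.lean` (the lists of the engine: segment bags
`segBagOf`, records `recListL`) and `TensorNetworkContractionRecords.lean`
(`val_netValue_recList_eq_acceptProb`). The engine evaluates the junction tree over `ℤ[ω]`:

* `engineZ wl N ops xb pars bagCodes cap = dpValue recOps 4 cap pars (bagCodes.map segBagOf) (recListL …)`;
* **`val_engineZ`**: on the lists of a circuit `C` on `|x⟩|0^m⟩` and of a rooted decomposition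
  `D` of its circuit graph, with `cap ≥ 4^{5 (width D + 1)}`, `val (engineZ …) = 2^{H} · P[wire 0 reads 1]`
  (`H` = number of Hadamard gates): the decomposition is valid and houses every record
  (`isRootedTD_rlists`, `scope_subset_segRooted_bag`), so `JT.dpValue_eq_netValue` applies;
* `hCountOps`, `prod_recWeight_eq_pow`; `capOf y = 1024 · |y|^{10} ≥ 4^{5 (w + 1)}` when
  `|y| ≥ 2^w` (`pow_le_capOf`);
* **`engineOut`** (the triple `(2 Re₀, q.re - q.im, 2^{H+1})`, or `(0, 0, 1)` without wires) and
  **`engineOut_spec`**: `p · 2^h = u + v √2`.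

## References

* [MarkovShi2008] I. L. Markov, Y. Shi, SIAM J. Comput. 38 (2008) 963–981, §4 (Thm 4.6 and its proof), §3 (Prop 3.5).
-/

noncomputable section

namespace Literature.Barriers.QuantumAdvantage

open Literature.Computability.Cryptography Literature.Computability.QuantumComplexity
  Literature.Combinatorics.SimpleGraph Literature.Combinatorics.SimpleGraph.ListTD
  Literature.LinearAlgebra.TensorNetworks Literature.LinearAlgebra.TensorNetworks.JT

variable {N : ℕ}

/-! ### Scopes of records lie in the segment scopes -/

/-- **Record scopes are numbered tensor scopes** (copy of the statement for the engine's housing).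
[folklore] -/
theorem scope_recOf_subset' (C : QCircuit cliffordT N) (A : Language Bool) (z₀ : QReg N) (obs : Fin N → Bool → ℂ)
    (w₀ : Fin N) (u : CircuitNode C.gates.length N) :
    ∀ x ∈ (recOf C z₀ w₀ u).scope, ∃ s ∈ (segmentNetwork C A z₀ obs).scope u, ((segIdx C s : Fin _) : ℕ) = x := by
  intro x hx
  cases u with
  | input w =>
    simp only [recOf, NodeRec.scope, List.mem_singleton] at hx
    exact ⟨segAt C w 0, by simp [segmentNetwork], hx ▸ rfl⟩
  | output w =>
    simp only [recOf, NodeRec.scope, List.mem_singleton] at hx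
    exact ⟨segAt C w (Fin.last _), by simp [segmentNetwork], hx ▸ rfl⟩
  | gate t =>
    have hscope : ∀ w ∈ (C.gates[(t : ℕ)]).wires, ∀ s ∈ ({segAt C w t.castSucc, segAt C w t.succ} : Finset (Seg C)),
        s ∈ (segmentNetwork C A z₀ obs).scope (.gate t) := fun w hw s hs =>
      Finset.mem_biUnion.2 ⟨w, hw, hs⟩
    rcases hg : C.gates[(t : ℕ)] with ⟨op, e⟩ | ⟨k, e⟩
    · have hw : ∀ j, e j ∈ (C.gates[(t : ℕ)]).wires := fun j => by
        rw [hg]; exact Finset.mem_map_of_mem _ (Finset.mem_univ j)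
      have hin : ∀ {k : ℕ} (f : Fin k ↪ Fin N) (j : Fin k), (∀ i, f i ∈ (C.gates[(t : ℕ)]).wires) →
          segAt C (f j) t.castSucc ∈ (segmentNetwork C A z₀ obs).scope (.gate t) ∧
          segAt C (f j) t.succ ∈ (segmentNetwork C A z₀ obs).scope (.gate t) := fun f j hf =>
        ⟨hscope _ (hf j) _ (by simp), hscope _ (hf j) _ (by simp)⟩
      cases op <;> simp only [recOf, hg, NodeRec.scope, List.mem_cons, List.not_mem_nil, or_false] at hx
      · rcases hx with rfl | rfl
        · exact ⟨_, (hin (embH e) 0 hw).1, rfl⟩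
        · exact ⟨_, (hin (embH e) 0 hw).2, rfl⟩
      · rcases hx with rfl | rfl
        · exact ⟨_, (hin (embS e) 0 hw).1, rfl⟩
        · exact ⟨_, (hin (embS e) 0 hw).2, rfl⟩
      · rcases hx with rfl | rfl
        · exact ⟨_, (hin (embT e) 0 hw).1, rfl⟩
        · exact ⟨_, (hin (embT e) 0 hw).2, rfl⟩
      · rcases hx with rfl | rfl | rfl | rfl
        · exact ⟨_, (hin (embC e) 0 hw).1, rfl⟩
        · exact ⟨_, (hin (embC e) 1 hw).1, rfl⟩
        · exact ⟨_, (hin (embC e) 0 hw).2, rfl⟩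
        · exact ⟨_, (hin (embC e) 1 hw).2, rfl⟩
    · simp [recOf, hg, NodeRec.scope] at hx

/-- Oracle-free Clifford+`T` gates act on at most two wires. [folklore] -/
theorem wires_card_le_two' {C : QCircuit cliffordT N} (hC : C.IsOracleFree) : ∀ g ∈ C.gates, g.wires.card ≤ 2 := by
  intro g hg
  have hof := hC g hg
  rcases g with ⟨op, e⟩ | ⟨k, e⟩
  · rw [QGate.wires, Finset.card_map, Finset.card_univ, Fintype.card_fin]
    cases op <;> decide
  · exact absurd hof id

/-! ### The Hadamard count and the rescaling -/

/-- The number of Hadamard gates among the kinds. [folklore] -/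
def hCountOps (ops : List ℕ) : ℕ := ops.count 1

/-- The weight of a gate node: `2` for a Hadamard gate, else `1`. [folklore] -/
theorem recWeight_gate (C : QCircuit cliffordT N) (t : Fin C.gates.length) :
    recWeight C (.gate t) = if opKind C.gates[(t : ℕ)] = 1 then 2 else 1 := by
  unfold recWeight
  rcases hg : C.gates[(t : ℕ)] with ⟨op, e⟩ | ⟨k, e⟩
  · cases op <;> simp [hg, opKind]
  · simp [hg, opKind]

/-- **The rescaling is `2^{H}`** with `H` the number of Hadamard gates. [folklore] -/
theorem prod_recWeight_eq_pow (C : QCircuit cliffordT N) : ∏ u, recWeight C u = 2 ^ hCountOps (opsOf C) := by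
  classical
  rw [prod_recWeight_eq]
  congr 1
  have hmap : (Finset.univ.filter fun u : CircuitNode C.gates.length N => recWeight C u = 2) =
      (Finset.univ.filter fun t : Fin C.gates.length => opKind C.gates[(t : ℕ)] = 1).map
        ⟨CircuitNode.gate, CircuitNode.gate_injective⟩ := by
    ext u
    simp only [Finset.mem_filter, Finset.mem_univ, true_and, Finset.mem_map, Function.Embedding.coeFn_mk]
    rcases u with w | t | w
    · simp [recWeight]
    · rw [recWeight_gate]
      constructor
      · intro h
        refine ⟨t, ?_, rfl⟩
        by_contra hk; rw [if_neg hk] at h; norm_num at h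
      · rintro ⟨t', ht', h⟩
        cases h
        rw [if_pos ht']
    · simp [recWeight]
  rw [hmap, Finset.card_map, card_filter_univ_fin_eq_countP C.gates (fun g => opKind g = 1), hCountOps, opsOf, List.count,
    List.countP_map]
  rfl

/-! ### The budget -/

/-- **The enumeration budget** read off the yardstick `y`: `1024 · |y|^{10}`. [folklore] -/
def capOf (y : List Bool) : ℕ := 1024 * y.length ^ 10

/-- `4^{5 (w + 1)} ≤ capOf y` when `|y| ≥ 2^w`. [folklore] -/
theorem pow_le_capOf {w : ℕ} {y : List Bool} (hy : 2 ^ w ≤ y.length) : 4 ^ (5 * (w + 1)) ≤ capOf y := by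
  unfold capOf
  have h1 : 4 ^ (5 * (w + 1)) = 1024 * (2 ^ w) ^ 10 := by
    rw [show (4 : ℕ) = 2 ^ 2 from rfl, ← pow_mul, ← pow_mul, show 2 * (5 * (w + 1)) = 10 + w * 10 by ring, pow_add, pow_mul]
    norm_num
  rw [h1]
  exact Nat.mul_le_mul_left _ (Nat.pow_le_pow_left hy 10)

/-! ### The engine value -/

/-- **The value computed by the engine**: the junction-tree evaluation of the records along the
listed segment decomposition (budget `cap`, domain `4` = (ket, bra) bit pairs).
[cite: MarkovShi2008, §4 (Thm 4.6, Steps 3–4)] -/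
def engineZ (wl : List (List ℕ)) (N : ℕ) (ops : List ℕ) (xb : List Bool) (pars : List ℕ) (bagCodes : List (List ℕ))
    (cap : ℕ) : ZOmega :=
  dpValue NodeRec.recOps 4 cap pars (bagCodes.map (segBagOf wl N)) (recListL wl N ops xb)

/-- The input register as bits with default `false`. [folklore] -/
theorem padInput_get_eq (x : List Bool) (m : ℕ) (w : Fin (x.length + m)) : padInput x.get m w = x.getD w false := by
  unfold padInput
  rw [List.getD_eq_getElem?_getD]
  by_cases h : (w : ℕ) < x.length
  · rw [List.getElem?_eq_getElem h, Option.getD_some]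
    conv_lhs => rw [show w = Fin.castAdd m ⟨w, h⟩ from Fin.ext rfl]
    rw [Fin.append_left]
    rfl
  · have hw := w.isLt
    rw [List.getElem?_eq_none (by omega), Option.getD_none]
    conv_lhs => rw [show w = Fin.natAdd x.length ⟨(w : ℕ) - x.length, by omega⟩ from Fin.ext (by simp; omega)]
    rw [Fin.append_right]

/-- **The engine value is `2^{H} ·` the acceptance probability** (oracle-free circuit on
`|x⟩|0^m⟩`, `N > 0` wires, rooted decomposition `D` of the circuit graph, budget `≥ 4^{5 (width D + 1)}`).
[cite: MarkovShi2008, §4 (Thm 4.6) and §3 (Prop 3.5)] -/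
theorem val_engineZ (x : List Bool) (m : ℕ) {C : QCircuit cliffordT (x.length + m)} (hC : C.IsOracleFree)
    (hN : 0 < x.length + m) {k : ℕ} (D : RootedTreeDecomposition (circuitGraph C) k) {cap : ℕ}
    (hcap : 4 ^ (5 * (D.width + 1)) ≤ cap) :
    ZOmega.val (engineZ (wlOf C) (x.length + m) (opsOf C) x D.rparList (D.rbagList CircuitNode.code) cap) =
      (2 : ℂ) ^ hCountOps (opsOf C) * (C.acceptProb 0 x.get : ℂ) := by
  set z₀ : QReg (x.length + m) := padInput x.get m with hz₀
  have hz : ∀ w : Fin (x.length + m), z₀ w = x.getD w false := padInput_get_eq x m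
  have hbags := rbagList_segRooted (C := C) 0 z₀ (obsOf ⟨0, hN⟩) D
  unfold engineZ
  rw [recListL_eq hN hz, ← hbags, ← prod_recWeight_eq_pow, ← val_netValue_recList_eq_acceptProb hC 0 x.get hN]
  congr 1
  set S := segRooted C 0 z₀ (obsOf ⟨0, hN⟩) D with hS
  have hinj : Function.Injective fun s : Seg C => ((segIdx C s : Fin (segCount C)) : ℕ) :=
    fun a b h => (segIdx C).injective (Fin.ext h)
  refine dpValue_eq_netValue (S.isRootedTD_rlists (segIdx C)) (by norm_num) (fun φ hφ => ?_)
    (fun φ _ a b hab => NodeRec.eval_congr φ hab) (fun t _ => ?_)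
  · -- every record is housed: its node lies in some bag of `D`
    obtain ⟨u, -, rfl⟩ := List.mem_map.1 hφ
    obtain ⟨i, hi⟩ := D.exists_mem_bag u
    rw [homeOf_lt_length_iff]
    have hlt : (i : ℕ) < (S.rbagList fun s => ((segIdx C s : Fin (segCount C)) : ℕ)).length := by
      rw [RootedTreeDecomposition.length_rbagList]; exact i.isLt
    refine ⟨_, List.getElem_mem hlt, fun v hv => ?_⟩
    rw [← bagOf_eq_getElem hlt]
    obtain ⟨s, hs, rfl⟩ := scope_recOf_subset' C 0 z₀ (obsOf ⟨0, hN⟩) ⟨0, hN⟩ u v hv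
    exact (S.mem_bagOf_rbagList hinj i s).2 (scope_subset_segRooted_bag C 0 z₀ (obsOf ⟨0, hN⟩) D hi hs)
  · -- the budget covers the bags
    refine le_trans (Nat.pow_le_pow_right (by norm_num) ((S.length_bagOf_rbagList_le _ t).trans
      (Finset.sup_le fun i _ => card_segRooted_bag_le_width C 0 z₀ (obsOf ⟨0, hN⟩) D (wires_card_le_two' hC) i))) ?_
    exact hcap

/-! ### The output -/

/-- **The output of the engine**: the triple `(u, v, 2^h)` with `p · 2^h = u + v√2` — from the
junction-tree value `Z` (`val Z = 2^H p`): `u = 2 Re p₀`, `v = q.re - q.im`, `h = H + 1`; without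
wires the probability is `0`: `(0, 0, 1)`. [cite: MarkovShi2008, §4 (Thm 4.6: "output the desired probability")] -/
def engineOut (wl : List (List ℕ)) (N : ℕ) (ops : List ℕ) (xb : List Bool) (pars : List ℕ) (bagCodes : List (List ℕ))
    (cap : ℕ) : ℤ × (ℤ × ℤ) :=
  if N = 0 then (0, (0, 1)) else
    (2 * (engineZ wl N ops xb pars bagCodes cap).p.re,
      ((engineZ wl N ops xb pars bagCodes cap).q.re - (engineZ wl N ops xb pars bagCodes cap).q.im, 2 ^ (hCountOps ops + 1)))

/-- Reading `p · 2^{H+1}` off the coordinates of `Z` with `val Z = 2^H p`. [folklore] -/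
theorem readout {Z : ZOmega} {p : ℝ} {H : ℕ} (hZ : ZOmega.val Z = (2 : ℂ) ^ H * (p : ℂ)) :
    p * 2 ^ (H + 1) = (2 * Z.p.re : ℤ) + ((Z.q.re - Z.q.im : ℤ) : ℝ) * Real.sqrt 2 := by
  have hre : (ZOmega.val Z).re = (Z.p.re : ℝ) + ((Z.q.re : ℝ) - Z.q.im) * (Real.sqrt 2 / 2) := by
    rw [ZOmega.val_eq_coords]; simp
  have hre' : (ZOmega.val Z).re = (2 : ℝ) ^ H * p := by
    rw [hZ, show (2 : ℂ) ^ H * (p : ℂ) = (((2 : ℝ) ^ H * p : ℝ) : ℂ) by push_cast; ring, Complex.ofReal_re]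
  rw [pow_succ]
  push_cast
  nlinarith [hre.symm.trans hre']

/-- **Correctness of the engine's output**: on the lists of `x`, an oracle-free circuit `C` on
`|x| + m` wires and a rooted decomposition `D` of its circuit graph, with a yardstick
`|y| ≥ 2^{width D}`, the output `(u, v, t)` has `t = 2^h` and `p · 2^h = u + v√2` for the
probability `p` that wire `0` reads `1`. [cite: MarkovShi2008, §4 (Thm 4.6 and its proof)] -/
theorem engineOut_spec (x : List Bool) (m : ℕ) {C : QCircuit cliffordT (x.length + m)} (hC : C.IsOracleFree)
    {k : ℕ} (D : RootedTreeDecomposition (circuitGraph C) k) {y : List Bool} (hy : 2 ^ D.width ≤ y.length) :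
    ∃ (u v : ℤ) (h : ℕ),
      engineOut (wlOf C) (x.length + m) (opsOf C) x D.rparList (D.rbagList CircuitNode.code) (capOf y) = (u, (v, 2 ^ h)) ∧
      (C.acceptProb 0 x.get : ℝ) * 2 ^ h = u + v * Real.sqrt 2 := by
  unfold engineOut
  split_ifs with hN
  · refine ⟨0, 0, 0, by simp, ?_⟩
    have : C.acceptProb 0 x.get = 0 := by
      unfold QCircuit.acceptProb
      exact Finset.sum_eq_zero fun y _ => by rw [dif_neg (by omega)]
    rw [this]; simp
  · have hNpos : 0 < x.length + m := Nat.pos_of_ne_zero hN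
    have hval := val_engineZ x m hC hNpos D (pow_le_capOf hy)
    refine ⟨_, _, hCountOps (opsOf C) + 1, rfl, ?_⟩
    have := readout hval
    push_cast at this ⊢
    linarith

end Literature.Barriers.QuantumAdvantage

end
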